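import Mathlib
import Summits.Ventures.PercRepro2.LocRows
import Summits.Ventures.PercRepro2.SwRow
import Summits.Ventures.PercRepro2.SwOut
import Summits.Ventures.PercRepro2.SwAllRow
import Summits.Ventures.PercRepro2.SwOutAll
import Summits.Ventures.PercRepro2.SwOutArmFlip
import Summits.Ventures.PercRepro2.SwOutArmThm
import Summits.Ventures.PercRepro2.SwOutCoreDefs
import Summits.Ventures.PercRepro2.SwOutCoreHull
import Summits.Ventures.PercRepro2.SwOutShadowDefs
import Summits.Ventures.PercRepro2.SwOutCoreShadowDefs
import Summits.Ventures.PercRepro2.SwOutShadowCube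
import Summits.Ventures.PercRepro2.SwOutShadowIneq
import Summits.Ventures.PercRepro2.SwOutCoreKey
import Summits.Ventures.PercRepro2.SwOutCoreShadowKey
import Summits.Ventures.PercRepro2.SwOutEdgeDefs
import Summits.Ventures.PercRepro2.SwOutEdgeHull

/-!
# The shadow base of a one-sided point of an e-core cube (blind cell PercRepro2, night-4 g16,
2026-08-26; proofs/NIGHT4-G15.md §4 (L3′, L4), proofs/NIGHT4-G16.md §3)

An e-core base `ζ` (the junction `u` adjacent to `h`, every arm and the h–u edges red) and a cube
point `ω₀ : Config (Option ι)` at which `u` is one-sided red — `u` red (`uRedE ω₀`), `u` not blue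
(`¬ uRedE (flipAll ω₀)`: the h–u edges are red at `ω₀` and no blue h-arm is adjacent to `u`) —
determine the same SHADOW DATA as in `SwOutCoreShadowDefs`, read on the arm coordinates
`ω₀ ∘ some`: `sX` = `u` with the red arms adjacent to `u`, `sZ` = the dropped (blue, pure) arms
adjacent to `u`, the far arms, and the shadow base `shadowOf` (the edges from `u` into `sZ` turned
blue; the h–u edges stay red).  **`CoreBaseE.shadowBase`**: this is a `ShadowBase` — the h–u edges
enter the arm `sX ∋ u`, so the shadow cube (`SwOutShadowCube` / `SwOutShadowIneq`) needs no change
in the adjacent case; `u` is inside-connected to `h` through the h–u edge itself.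
-/

namespace Summit.Ventures.PercRepro2

namespace LocRows

open Hull

variable {V : Type*} {E : Type*}

open scoped Classical

variable {ends : E → Sym2 V}

section ShadowBaseE

variable {ι : Type*} {A : ι → Set V} {pure : ι → Prop} {ζ : Config E} {h u : V} {H : Set V}
  (hb : CoreBaseE ends ζ h u H A pure) {ω₀ : Config ι}
include hb

/-- A pure arm is adjacent to `u`. -/
lemma CoreBaseE.uAdjC_of_pure {i : ι} (hp : pure i) : uAdjC ends u A i := by
  obtain ⟨x, hx⟩ := hb.arm_nonempty i
  have hconn := hb.pure_conn i hp x hx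
  by_contra hadj
  have key : x ∈ ({u} : Set V) := by
    refine mem_of_conn_of_closed (ends := ends) (ω := insideConfig ends (A i ∪ {u}) ζ) ?_ rfl hconn
    intro a ha b hab
    obtain ⟨hne, e, he, hends⟩ := openGraph_adj.1 hab
    rw [Set.mem_singleton_iff] at ha
    subst ha
    obtain ⟨_, y, hy, y', hy', hyy'⟩ := insideConfig_eq_true_iff.1 he
    exfalso
    have hb' : b ∈ A i := by
      rw [hends, Sym2.eq_iff] at hyy'
      rcases hyy' with ⟨_, h2⟩ | ⟨_, h2⟩
      · rcases hy' with hy' | hy'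
        · exact h2 ▸ hy'
        · rw [Set.mem_singleton_iff] at hy'; exact absurd (h2.trans hy').symm hne
      · rcases hy with hy | hy
        · exact h2 ▸ hy
        · rw [Set.mem_singleton_iff] at hy; exact absurd (h2.trans hy).symm hne
    exact hadj ⟨e, b, hends, hb'⟩
  rw [Set.mem_singleton_iff] at key
  exact (hb.arm_sub i x hx).2.2 key

/-- A far arm (not adjacent to `u`) is an h-arm. -/
lemma CoreBaseE.not_pure_of_not_uAdjC {i : ι} (hi : ¬ uAdjC ends u A i) : ¬ pure i :=
  fun hp => hi (hb.uAdjC_of_pure hp)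

/-- `{h} ∪ sX ∪ far arms ∪ sZ = H`. -/
lemma CoreBaseE.shadow_region_eq :
    {h} ∪ {x | ∃ j, x ∈ sB ends u A ω₀ j} ∪ sZ ends u A ω₀ = H := by
  ext x
  simp only [Set.mem_union, Set.mem_singleton_iff, Set.mem_setOf_eq]
  constructor
  · rintro ((rfl | ⟨j, hj⟩) | hx)
    · exact hb.h_mem
    · rcases j with _ | ⟨i, hi⟩
      · simp only [sB] at hj
        rcases (mem_sX_iff.1 hj) with rfl | ⟨i, _, _, hx⟩
        · exact hb.u_mem
        · exact (hb.arm_sub i x hx).1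
      · exact (hb.arm_sub i x hj).1
    · obtain ⟨i, _, _, hx⟩ := hx
      exact (hb.arm_sub i x hx).1
  · intro hxH
    by_cases hxh : x = h
    · exact Or.inl (Or.inl hxh)
    by_cases hxu : x = u
    · exact Or.inl (Or.inr ⟨none, by simp only [sB]; exact mem_sX_iff.2 (Or.inl hxu)⟩)
    obtain ⟨i, hxi⟩ := hb.arm_cover x hxH hxh hxu
    by_cases hadj : uAdjC ends u A i
    · cases hω : ω₀ i with
      | true =>
        exact Or.inl (Or.inr ⟨none, by
          simp only [sB]; exact mem_sX_iff.2 (Or.inr ⟨i, hadj, hω, hxi⟩)⟩)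
      | false => exact Or.inr ⟨i, hadj, hω, hxi⟩
    · exact Or.inl (Or.inr ⟨some ⟨i, hadj⟩, hxi⟩)

omit hb in
/-- A vertex of `sX` other than `u` lies in a red arm adjacent to `u`. -/
lemma CoreBaseE.exists_arm_of_mem_sX {x : V} (hx : x ∈ sX ends u A ω₀) (hxu : x ≠ u) :
    ∃ i, uAdjC ends u A i ∧ ω₀ i = true ∧ x ∈ A i := by
  rcases mem_sX_iff.1 hx with rfl | h'
  · exact absurd rfl hxu
  · exact h'

/-- An edge between a vertex of `sX` and a vertex of an arm `A j` assigned `false` or not adjacent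
to `u` leaves from `u`. -/
lemma CoreBaseE.eq_u_of_edge_sX {e : E} {x y : V} {j : ι} (hxy : ends e = s(x, y))
    (hx : x ∈ sX ends u A ω₀) (hy : y ∈ A j) (hj : ¬ (uAdjC ends u A j ∧ ω₀ j = true)) : x = u := by
  by_contra hxu
  obtain ⟨i, hi, hωi, hxi⟩ := CoreBaseE.exists_arm_of_mem_sX hx hxu
  have : i = j := hb.arm_eq_of_edge hxy hxi hy
  subst this
  exact hj ⟨hi, hωi⟩

omit hb in
/-- A blue arm adjacent to `u` is pure when no blue h-arm is adjacent to `u`. -/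
lemma CoreBaseE.pure_of_mem_sZ (huB : ¬ uRed ends A u pure (flipAll ω₀)) {i : ι}
    (hi : uAdjC ends u A i) (hω : ω₀ i = false) : pure i := by
  by_contra hp
  obtain ⟨e, x, hux, hx⟩ := hi
  exact huB ⟨i, by simp [flipAll, hω], hp, e, x, hux, hx⟩

end ShadowBaseE

section ShadowBase

variable {ι : Type*} {A : ι → Set V} {pure : ι → Prop} {ζ : Config E} {h u : V} {H : Set V}
  (hb : CoreBaseE ends ζ h u H A pure) {ω₀ : Config (Option ι)}
  (huR : uRedE ends A u pure ω₀) (huB : ¬ uRedE ends A u pure (flipAll ω₀))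
include hb huR huB

omit hb huR in
/-- At a red-one-sided point no blue h-arm is adjacent to `u`. -/
lemma CoreBaseE.not_uRed_flipAll_of_oneSided : ¬ uRed ends A u pure (flipAll (ω₀ ∘ some)) :=
  fun h' => huB (Or.inr (by rw [flipAll_comp_some]; exact h'))

omit hb huR in
/-- At a red-one-sided point the h–u edges are red. -/
lemma CoreBaseE.none_eq_true_of_oneSided : ω₀ none = true := by
  by_contra hn
  apply huB
  left
  simp only [flipAll]
  simpa using hn

omit huR in
/-- **The shadow base of a one-sided point of an e-core cube is a shadow base** (the h–u edges
enter the arm `sX ∋ u`; only «`u` not blue» is needed — `u` is red through the h–u edge). -/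
theorem CoreBaseE.shadowBase :
    ShadowBase ends (shadowOf ends u A (ω₀ ∘ some) ζ) h (sZ ends u A (ω₀ ∘ some))
      (sB ends u A (ω₀ ∘ some)) none where
  h_notMem_B := by
    rintro (_ | ⟨i, hi⟩) hh
    · simp only [sB] at hh
      rcases mem_sX_iff.1 hh with hh | ⟨i, _, _, hh⟩
      · exact hb.hne hh
      · exact hb.h_notMem_arm i hh
    · exact hb.h_notMem_arm i hh
  h_notMem_Z := by
    rintro ⟨i, _, _, hh⟩
    exact hb.h_notMem_arm i hh
  B_disj := by
    rintro (_ | ⟨i, hi⟩) (_ | ⟨j, hj⟩) hne x hx hx'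
    · exact hne rfl
    · simp only [sB] at hx hx'
      rcases mem_sX_iff.1 hx with rfl | ⟨i', hi', _, hx⟩
      · exact hb.u_notMem_arm j hx'
      · have : i' = j := by
          by_contra hne'
          exact hb.arm_disj i' j hne' x hx hx'
        exact hj (this ▸ hi')
    · simp only [sB] at hx hx'
      rcases mem_sX_iff.1 hx' with rfl | ⟨j', hj', _, hx'⟩
      · exact hb.u_notMem_arm i hx
      · have : i = j' := by
          by_contra hne'
          exact hb.arm_disj i j' hne' x hx hx'
        exact hi (this ▸ hj')
    · simp only [sB] at hx hx'
      have hij : i ≠ j := fun h' => hne (by subst h'; rfl)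
      exact hb.arm_disj i j hij x hx hx'
  B_disj_Z := by
    rintro (_ | ⟨i, hi⟩) x hx ⟨j, hj, hωj, hxj⟩
    · simp only [sB] at hx
      rcases mem_sX_iff.1 hx with rfl | ⟨i', _, hωi', hx⟩
      · exact hb.u_notMem_arm j hxj
      · have : i' = j := by
          by_contra hne'
          exact hb.arm_disj i' j hne' x hx hxj
        subst this
        rw [hωi'] at hωj; exact absurd hωj (by decide)
    · simp only [sB] at hx
      have : i = j := by
        by_contra hne'
        exact hb.arm_disj i j hne' x hx hxj
      exact hi (this ▸ hj)
  B_nonempty := by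
    rintro (_ | ⟨i, hi⟩)
    · exact ⟨u, mem_sX_iff.2 (Or.inl rfl)⟩
    · exact hb.arm_nonempty i
  bdry_blue := by
    intro e x y hxy hxR hyR
    rw [hb.shadow_region_eq] at hxR hyR
    have hyu : y ≠ u := fun h' => hyR (h' ▸ hb.u_mem)
    have hnot : ¬ ∃ z ∈ sZ ends u A (ω₀ ∘ some), ends e = s(u, z) := by
      rintro ⟨z, hz, hez⟩
      rw [hxy, Sym2.eq_iff] at hez
      rcases hez with ⟨_, h2⟩ | ⟨_, h2⟩
      · obtain ⟨i, _, _, hzi⟩ := hz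
        exact hyR (h2 ▸ (hb.arm_sub i z hzi).1)
      · exact hyu h2
    rw [shadowOf_apply_of_not hnot]
    exact hb.bdry_blue e x y hxy hxR hyR
  no_cross := by
    rintro (_ | ⟨i, hi⟩) (_ | ⟨j, hj⟩) hne e x y hxy hx hy
    · exact hne rfl
    · simp only [sB] at hx hy
      have hxu : x = u := hb.eq_u_of_edge_sX hxy hx hy (fun h' => hj h'.1)
      subst hxu
      exact hj ⟨e, y, hxy, hy⟩
    · simp only [sB] at hx hy
      have hyu : y = u := hb.eq_u_of_edge_sX (ends_swap hxy) hy hx (fun h' => hi h'.1)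
      subst hyu
      exact hi ⟨e, x, ends_swap hxy, hx⟩
    · simp only [sB] at hx hy
      have hij : i ≠ j := fun h' => hne (by subst h'; rfl)
      exact hb.no_cross i j hij e x y hxy hx hy
  no_BZ := by
    rintro (_ | ⟨i, hi⟩) hne e x y hxy hx ⟨j, hj, _, hyj⟩
    · exact hne rfl
    · simp only [sB] at hx
      have hij : i ≠ j := fun h' => hi (h' ▸ hj)
      exact hb.no_cross i j hij e x y hxy hx hyj
  no_hZ := by
    rintro e y hey ⟨j, hj, hωj, hyj⟩
    exact hb.pure_no_h j
      (CoreBaseE.pure_of_mem_sZ (CoreBaseE.not_uRed_flipAll_of_oneSided huB) hj hωj) e y hey hyj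
  kZ_blue := by
    intro e x y hxy hx hy
    simp only [sB] at hx
    obtain ⟨j, hj, hωj, hyj⟩ := hy
    have hxu : x = u := hb.eq_u_of_edge_sX hxy hx hyj (fun h' => by
      rw [h'.2] at hωj; exact absurd hωj (by decide))
    subst hxu
    rw [shadowOf_apply_of_mem_sZ ⟨j, hj, hωj, hyj⟩ hxy, hb.u_red e y hxy]
    rfl
  h_edges := by
    intro e x hxe
    rcases hb.h_edges e x hxe with rfl | ⟨i, hxi⟩
    · exact ⟨none, by simp only [sB]; exact mem_sX_iff.2 (Or.inl rfl)⟩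
    by_cases hadj : uAdjC ends u A i
    · cases hω : (ω₀ ∘ some) i with
      | true => exact ⟨none, by simp only [sB]; exact mem_sX_iff.2 (Or.inr ⟨i, hadj, hω, hxi⟩)⟩
      | false =>
        exfalso
        exact hb.pure_no_h i
          (CoreBaseE.pure_of_mem_sZ (CoreBaseE.not_uRed_flipAll_of_oneSided huB) hadj hω) e x hxe
          hxi
    · exact ⟨some ⟨i, hadj⟩, hxi⟩
  h_red := by
    intro e x hxe
    by_cases hxu : x = u
    · -- the h–u edge: not an edge from `u` into a dropped arm
      rw [shadowOf_apply_of_not]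
      · exact hb.h_red e x hxe
      · rintro ⟨z, ⟨j, _, _, hzj⟩, hez⟩
        rw [hxe, hxu, Sym2.eq_iff] at hez
        rcases hez with ⟨h1, _⟩ | ⟨h2, _⟩
        · exact hb.hne h1
        · exact hb.h_notMem_arm j (by rw [h2]; exact hzj)
    · rw [shadowOf_apply_of_notMem_u]
      · exact hb.h_red e x hxe
      · rw [hxe, Sym2.mem_iff]
        rintro (h' | h')
        · exact hb.hne h'.symm
        · exact hxu h'.symm
  B_conn := by
    rintro (_ | ⟨i, hi⟩) x hx
    · -- the coarse arm of `u`
      simp only [sB] at hx ⊢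
      have hZ : ∀ z ∈ sZ ends u A (ω₀ ∘ some), z ∉ sX ends u A (ω₀ ∘ some) ∪ {h} := by
        rintro z ⟨j, _, hωj, hzj⟩ (hz | hz)
        · rcases mem_sX_iff.1 hz with rfl | ⟨i', _, hωi', hzi'⟩
          · exact hb.u_notMem_arm j hzj
          · have : i' = j := by
              by_contra hne'
              exact hb.arm_disj i' j hne' z hzi' hzj
            subst this
            rw [hωi'] at hωj; exact absurd hωj (by decide)
        · rw [Set.mem_singleton_iff] at hz
          exact hb.h_notMem_arm j (hz ▸ hzj)
      rw [insideConfig_shadowOf hZ]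
      -- `u` is inside-connected to `h` through the h–u edge
      obtain ⟨e₀, he₀⟩ := hb.hu_exists
      have huc : u ∈ cluster ends (insideConfig ends (sX ends u A (ω₀ ∘ some) ∪ {h}) ζ) h := by
        refine mem_cluster_of_edge (mem_cluster_self _ _ _) ?_ he₀
        exact insideConfig_eq_true_iff.2 ⟨hb.hu_red he₀, h, Or.inr rfl, u,
          Or.inl (mem_sX_iff.2 (Or.inl rfl)), he₀⟩
      rcases mem_sX_iff.1 hx with rfl | ⟨i, hi, hωi, hxi⟩
      · exact huc
      · have hsub : A i ∪ {h} ⊆ sX ends u A (ω₀ ∘ some) ∪ {h} := by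
          rintro y (hy | hy)
          · exact Or.inl (mem_sX_iff.2 (Or.inr ⟨i, hi, hωi, hy⟩))
          · exact Or.inr hy
        by_cases hp : pure i
        · have hsub' : A i ∪ {u} ⊆ sX ends u A (ω₀ ∘ some) ∪ {h} := by
            rintro y (hy | hy)
            · exact Or.inl (mem_sX_iff.2 (Or.inr ⟨i, hi, hωi, hy⟩))
            · rw [Set.mem_singleton_iff] at hy
              exact Or.inl (mem_sX_iff.2 (Or.inl hy))
          have := cluster_mono (insideConfig_mono_set hsub' ζ) u (hb.pure_conn i hp x hxi)
          exact conn_trans huc this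
        · exact cluster_mono (insideConfig_mono_set hsub ζ) h (hb.harm_conn i hp x hxi)
    · -- a far arm: an h-arm, inside-connected in the base
      simp only [sB] at hx ⊢
      have hZ : ∀ z ∈ sZ ends u A (ω₀ ∘ some), z ∉ A i ∪ {h} := by
        rintro z ⟨j, hj, _, hzj⟩ (hz | hz)
        · have : i = j := by
            by_contra hne'
            exact hb.arm_disj i j hne' z hz hzj
          exact hi (this ▸ hj)
        · rw [Set.mem_singleton_iff] at hz
          exact hb.h_notMem_arm j (hz ▸ hzj)
      rw [insideConfig_shadowOf hZ]
      exact hb.harm_conn i (hb.not_pure_of_not_uAdjC hi) x hx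

end ShadowBase

section Block

variable {ι : Type*}

/-- The e-cube point above an arm point, with the h–u edges red. -/
def withHuRed (ω : Config ι) : Config (Option ι) := fun j => j.elim true ω

/-- The arm coordinates of `withHuRed ω` are `ω`. -/
lemma withHuRed_comp_some (ω : Config ι) : withHuRed ω ∘ some = ω := rfl

/-- The e-coordinate of `withHuRed ω`. -/
lemma withHuRed_none (ω : Config ι) : withHuRed ω none = true := rfl

variable [Fintype E] [DecidableEq E] {h u l o : V} {U : Set V}

/-- **The rigid inequality on a shadow block of the adjacent case**: for an e-core base `b` on
the concrete arms `S` (hull inside `U`, `l ∉ U`) and a red set `R` of arms with no blue h-arm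
adjacent to `u`, the shadow block `shadowBlock b S R` (the shadow cube of the one-sided point red
exactly on `R`) satisfies the rigid counting inequality. -/
theorem shadowBlockE_card_le {b : Config E} {S R : Finset (Set V)} (hl : l ∉ U)
    (hHU : extHull ends b h u ⊆ U)
    (hb : CoreBaseE ends b h u (extHull ends b h u) (armsFun S) (pureFun ends h S))
    (huB : ¬ uRed ends (armsFun S) u (pureFun ends h S) (flipAll (omegaSR S R)))
    {𝓔 : Set (Set E)} (h𝓔 : IsUpperSet 𝓔) :
    ((shadowBlock ends u b S R).filter fun ζ' =>
        ζ' ∈ tgtU ends l h {T : Set V | o ∈ T} ∧ redEdges ends ζ' h ∈ 𝓔).card ≤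
      ((shadowBlock ends u b S R).filter fun ζ' =>
        ζ' ∈ tgtU ends l h {T : Set V | o ∈ T} ∧ blueEdges ends ζ' h ∈ 𝓔).card := by
  have huB' : ¬ uRedE ends (armsFun S) u (pureFun ends h S)
      (flipAll (withHuRed (omegaSR S R))) := by
    rintro (hn | hr)
    · exact absurd hn (by simp [flipAll, withHuRed])
    · rw [flipAll_comp_some, withHuRed_comp_some] at hr
      exact huB hr
  have key := (hb.shadowBase huB').card_shadowCube_le (l := l) (o := o) ?_ h𝓔
  · rw [withHuRed_comp_some] at key
    exact key
  · rw [hb.shadow_region_eq]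
    exact fun h' => hl (hHU h')

end Block

end LocRows

end Summit.Ventures.PercRepro2
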